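import Summits.ResolutionOfSingularities.ResolutionOfSingularities.Theorems.RadicialJungCleanModelsCcurveRebaseD2Gen
import Summits.ResolutionOfSingularities.ResolutionOfSingularities.Theorems.RadicialJungCleanModelsCcurvePersistForm2Gen
import Summits.ResolutionOfSingularities.ResolutionOfSingularities.Theorems.RadicialJungCleanModelsCcurveCentreCurveOf
import Summits.ResolutionOfSingularities.ResolutionOfSingularities.Theorems.RadicialJungCleanModelsCcurveLiftOfGen
import Summits.ResolutionOfSingularities.ResolutionOfSingularities.Theorems.RadicialJungCleanModelsCcurvePersistForm1Gen
import Summits.ResolutionOfSingularities.ResolutionOfSingularities.Theorems.RadicialJungCleanModelsCcurvePersistForm3Gen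
import HarnessLib

/-!
# [GENERAL-FIELD VERSION (lead g7, Sketch rev 30): the `[PerfectField k]` binders REMOVED throughout — rebaseD2_gen, lift_of_gen, persistForm1/2/3_gen_of; `persistForm2_gen_of` is the NEW unit case via Kuhlmann-defectlessness of the residue valuation ring.]
# Route `RadicialJung`, crux `CleanModels` (stmt-15917) — (C-curve) sub-line: THE ASSEMBLY, modulo the geometric core `curveRegularize` and F-02

Lead `res-B-lead-1` g7 (plan `Cruxes/CleanModels/Lines/Sketch-memo-Ccurve-plan.md`; workfile `Lines/Sketch_Ccurve_assembly.lean` v2.9, whose only remaining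
`sorry` is the S3-core `stub_Cc_curveRegularize`).  OURS · counted 0.  Nothing here proves resolution in characteristic `p`; resolution in char `p` is NOT proved.

`cleanLU3Defect_of_properCoarsening_perfect_of (hReg) (hCP)`: clean local uniformization of the `K^p`-line of `g₀` (loose-clean form at a regular 3-dimensional
finitely generated centre) at a zero-dimensional valuation ring `O` with NO divisorial coarsening and a PROPER coarsening `O₁`, over a PERFECT ground field of
characteristic `p` — i.e. the composite part of the research residual :249‴ of line `Sketch` over perfect fields — from
* (hReg) the S3-core `stub_Cc_curveRegularize` WITHOUT its F-32 binder, stated as a closed proposition: the centre curve of `O₁` made regular at the centre of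
  `O` by blow-ups inside `locAtCentre B O₁` (to be discharged from F-32 = `CossartJannsenSaito2020Embedded`, or classically);
* (hCP) F-02 = `CossartPiltant2019` (through ✓ `Ccurve.rebaseD2`).
Kernel-checked composition of the landed nodes: ✓ `Ccurve.rebaseD2` (D2 at the rebased coarsening), ✓ `Ccurve.lift_of` ∘ ✓ `Ccurve.centreCurve_of` (the lift),
✓ `Ccurve.persistForm1_of` / ✓ `persistForm2_of` / ✓ `persistForm3_of` (closed-point persist by form).  `liftedD2_of`, `persist_of` are the intermediate nodes.
-/

noncomputable section

set_option linter.dupNamespace false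

open IsLocalRing Literature.AlgebraicGeometry.Resolution
open Summit.ResolutionOfSingularities.ResolutionOfSingularities.Theorems

namespace Summit.ResolutionOfSingularities.ResolutionOfSingularities.Theorems.RadicialJung.CleanModels.Ccurve

/-- NODE `liftedD2` from ✓ `rebaseD2` and ✓ `lift_of (centreCurve_of hReg)` (transport of the clean representative along `locAtCentre B′ O₁ = R₁`). [folklore] -/
theorem liftedD2_gen_of
    (hReg :
    ∀ (k : Type) [Field k] (K : Type) [Field K] [Algebra k K]
    (O : ValuationSubring K) (A : Subalgebra k K), A.toSubring ≤ O.toSubring → A.FG → IsFractionRing A K → ringKrullDim A ≤ 3 →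
    (∀ (T : Subring K) (hT : T ≤ O.toSubring), A.toSubring ≤ T → (subringCentre T O hT).IsMaximal) →
    ∀ (B : Subalgebra k K) (hBO : B.toSubring ≤ O.toSubring), A ≤ B → B.FG →
    IsRegularLocalRing (locAtCentre B.toSubring O) → ringKrullDim (locAtCentre B.toSubring O) = 3 →
    ∀ (O₁ : ValuationSubring K) (hOO₁ : O ≤ O₁), ringKrullDim (locAtCentre B.toSubring O₁) = 2 →
    ∃ (B' : Subalgebra k K) (hB'O : B'.toSubring ≤ O.toSubring), B ≤ B' ∧ B'.FG ∧
    IsRegularLocalRing (locAtCentre B'.toSubring O) ∧ ringKrullDim (locAtCentre B'.toSubring O) = 3 ∧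
    B'.toSubring ≤ locAtCentre B.toSubring O₁ ∧
    IsRegularLocalRing (↥(locAtCentre B'.toSubring O) ⧸
      subringCentre (locAtCentre B'.toSubring O) O₁ (fun _ hw => hOO₁ (locAtCentre_le hB'O hw))) ∧
    ringKrullDim (↥(locAtCentre B'.toSubring O) ⧸
      subringCentre (locAtCentre B'.toSubring O) O₁ (fun _ hw => hOO₁ (locAtCentre_le hB'O hw))) = 1 )
    (hCP : CossartPiltant2019.{0}) :
    ∀ (p : ℕ), p.Prime →
    ∀ (k : Type) [Field k] [CharP k p] (K : Type) [Field K] [Algebra k K]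
    (O : ValuationSubring K) (A : Subalgebra k K), A.toSubring ≤ O.toSubring → A.FG → IsFractionRing A K →
    ringKrullDim A ≤ 3 → IsRegularLocalRing (locAtCentre A.toSubring O) →
    ringKrullDim (locAtCentre A.toSubring O) = 3 →
    (∀ (T : Subring K) (hT : T ≤ O.toSubring), A.toSubring ≤ T → (subringCentre T O hT).IsMaximal) →
    ∀ g₀ : K, (∀ c : K, c ^ p ≠ g₀) →
    ¬ (∃ (O₁ : ValuationSubring K), O ≤ O₁ ∧ O₁ ≠ ⊤ ∧ ∃ y : Fin 2 → K, (∀ i, y i ∈ O) ∧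
      ∀ P : MvPolynomial (Fin 2) k, P ≠ 0 → O₁.valuation (MvPolynomial.aeval y P) = 1) →
    ∀ (O₁ : ValuationSubring K), O ≤ O₁ → O₁ ≠ O → O₁ ≠ ⊤ →
    ∃ (B : Subalgebra k K), B.toSubring ≤ O.toSubring ∧ A ≤ B ∧ B.FG ∧
    IsRegularLocalRing (locAtCentre B.toSubring O) ∧ ringKrullDim (locAtCentre B.toSubring O) = 3 ∧
    ringKrullDim ↥(locAtCentre B.toSubring O₁) = 2 ∧
    ∃ (_ : IsRegularLocalRing ↥(locAtCentre B.toSubring O₁)) (c : Fin p → K), (∃ j : Fin p, (j : ℕ) ≠ 0 ∧ c j ≠ 0) ∧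
    ((∃ (d m : ℕ) (hmd : m ≤ d) (t : Fin d → ↥(locAtCentre B.toSubring O₁)) (a : Fin m → ℕ) (u : ↥(locAtCentre B.toSubring O₁)), IsUnit u ∧
    Ideal.span (Set.range t) = IsLocalRing.maximalIdeal ↥(locAtCentre B.toSubring O₁) ∧
    ringKrullDim ↥(locAtCentre B.toSubring O₁) = (d : WithBot ℕ∞) ∧ 0 < m ∧ (∀ i, ¬ p ∣ a i) ∧
    (∑ j : Fin p, c j ^ p * g₀ ^ (j : ℕ)) = (u : K) * ∏ i : Fin m, ((t (Fin.castLE hmd i) : ↥(locAtCentre B.toSubring O₁)) : K) ^ (a i)) ∨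
    (∃ u : ↥(locAtCentre B.toSubring O₁), IsUnit u ∧ (∑ j : Fin p, c j ^ p * g₀ ^ (j : ℕ)) = (u : K) ∧
    ∀ c' : ↥(locAtCentre B.toSubring O₁), u - c' ^ p ∉ IsLocalRing.maximalIdeal ↥(locAtCentre B.toSubring O₁)) ∨
    (∃ s c' : ↥(locAtCentre B.toSubring O₁), (∑ j : Fin p, c j ^ p * g₀ ^ (j : ℕ)) = (s : K) ∧
    s - c' ^ p ∈ IsLocalRing.maximalIdeal ↥(locAtCentre B.toSubring O₁) ∧
    s - c' ^ p ∉ IsLocalRing.maximalIdeal ↥(locAtCentre B.toSubring O₁) ^ 2)) := by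
  intro p hp k _ _ K _ _ O A hAO hAfg hfrac hdimA hreg hdim3 hzd g₀ hg₀ hdiv O₁ hOO₁ hne hO₁
  obtain ⟨B, hBO, hAB, hBfg, hBreg, hBdim, hB1reg, hB1dim, hB1of, R₁, hR₁O₁, hdom, hdom₁, hR₁dim, hR₁reg, c, hc, hforms⟩ :=
    rebaseD2_gen hCP p hp k K O A hAO hAfg hfrac hdimA hreg hdim3 hzd g₀ hg₀ hdiv O₁ hOO₁ hne hO₁
  obtain ⟨B', hB'O, hBB', hB'fg, hB'reg, hB'dim, hloc⟩ :=
    lift_of_gen (centreCurve_of hReg) p hp k K O A hAO hAfg hfrac hdimA hreg hdim3 hzd g₀ hg₀ hdiv O₁ hOO₁ hne hO₁ B hBO hAB hBfg hBreg hBdim hB1reg hB1dim hB1of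
      R₁ hR₁O₁ hdom hdom₁ hR₁reg hR₁dim
  refine ⟨B', hB'O, hAB.trans hBB', hB'fg, hB'reg, hB'dim, ?_⟩
  rw [hloc]
  exact ⟨hR₁dim, hR₁reg, c, hc, hforms⟩

/-- NODE `persist` from ✓ `persistForm1_of` / ✓ `persistForm2_of` / ✓ `persistForm3_of`, all applied to ✓ `centreCurve_of hReg`. [folklore] -/
theorem persist_gen_of
    (hReg :
    ∀ (k : Type) [Field k] (K : Type) [Field K] [Algebra k K]
    (O : ValuationSubring K) (A : Subalgebra k K), A.toSubring ≤ O.toSubring → A.FG → IsFractionRing A K → ringKrullDim A ≤ 3 →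
    (∀ (T : Subring K) (hT : T ≤ O.toSubring), A.toSubring ≤ T → (subringCentre T O hT).IsMaximal) →
    ∀ (B : Subalgebra k K) (hBO : B.toSubring ≤ O.toSubring), A ≤ B → B.FG →
    IsRegularLocalRing (locAtCentre B.toSubring O) → ringKrullDim (locAtCentre B.toSubring O) = 3 →
    ∀ (O₁ : ValuationSubring K) (hOO₁ : O ≤ O₁), ringKrullDim (locAtCentre B.toSubring O₁) = 2 →
    ∃ (B' : Subalgebra k K) (hB'O : B'.toSubring ≤ O.toSubring), B ≤ B' ∧ B'.FG ∧
    IsRegularLocalRing (locAtCentre B'.toSubring O) ∧ ringKrullDim (locAtCentre B'.toSubring O) = 3 ∧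
    B'.toSubring ≤ locAtCentre B.toSubring O₁ ∧
    IsRegularLocalRing (↥(locAtCentre B'.toSubring O) ⧸
      subringCentre (locAtCentre B'.toSubring O) O₁ (fun _ hw => hOO₁ (locAtCentre_le hB'O hw))) ∧
    ringKrullDim (↥(locAtCentre B'.toSubring O) ⧸
      subringCentre (locAtCentre B'.toSubring O) O₁ (fun _ hw => hOO₁ (locAtCentre_le hB'O hw))) = 1 ) :
    ∀ (p : ℕ), p.Prime →
    ∀ (k : Type) [Field k] [CharP k p] (K : Type) [Field K] [Algebra k K]
    (O : ValuationSubring K) (A : Subalgebra k K), A.toSubring ≤ O.toSubring → A.FG → IsFractionRing A K →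
    ringKrullDim A ≤ 3 → IsRegularLocalRing (locAtCentre A.toSubring O) →
    ringKrullDim (locAtCentre A.toSubring O) = 3 →
    (∀ (T : Subring K) (hT : T ≤ O.toSubring), A.toSubring ≤ T → (subringCentre T O hT).IsMaximal) →
    ∀ g₀ : K, (∀ c : K, c ^ p ≠ g₀) →
    ¬ (∃ (O₁ : ValuationSubring K), O ≤ O₁ ∧ O₁ ≠ ⊤ ∧ ∃ y : Fin 2 → K, (∀ i, y i ∈ O) ∧
      ∀ P : MvPolynomial (Fin 2) k, P ≠ 0 → O₁.valuation (MvPolynomial.aeval y P) = 1) →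
    ∀ (O₁ : ValuationSubring K), O ≤ O₁ → O₁ ≠ O → O₁ ≠ ⊤ →
    ∀ (B : Subalgebra k K), B.toSubring ≤ O.toSubring → A ≤ B → B.FG →
    IsRegularLocalRing (locAtCentre B.toSubring O) → ringKrullDim (locAtCentre B.toSubring O) = 3 →
    ringKrullDim ↥(locAtCentre B.toSubring O₁) = 2 →
    (∃ (_ : IsRegularLocalRing ↥(locAtCentre B.toSubring O₁)) (c : Fin p → K), (∃ j : Fin p, (j : ℕ) ≠ 0 ∧ c j ≠ 0) ∧
    ((∃ (d m : ℕ) (hmd : m ≤ d) (t : Fin d → ↥(locAtCentre B.toSubring O₁)) (a : Fin m → ℕ) (u : ↥(locAtCentre B.toSubring O₁)), IsUnit u ∧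
    Ideal.span (Set.range t) = IsLocalRing.maximalIdeal ↥(locAtCentre B.toSubring O₁) ∧
    ringKrullDim ↥(locAtCentre B.toSubring O₁) = (d : WithBot ℕ∞) ∧ 0 < m ∧ (∀ i, ¬ p ∣ a i) ∧
    (∑ j : Fin p, c j ^ p * g₀ ^ (j : ℕ)) = (u : K) * ∏ i : Fin m, ((t (Fin.castLE hmd i) : ↥(locAtCentre B.toSubring O₁)) : K) ^ (a i)) ∨
    (∃ u : ↥(locAtCentre B.toSubring O₁), IsUnit u ∧ (∑ j : Fin p, c j ^ p * g₀ ^ (j : ℕ)) = (u : K) ∧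
    ∀ c' : ↥(locAtCentre B.toSubring O₁), u - c' ^ p ∉ IsLocalRing.maximalIdeal ↥(locAtCentre B.toSubring O₁)) ∨
    (∃ s c' : ↥(locAtCentre B.toSubring O₁), (∑ j : Fin p, c j ^ p * g₀ ^ (j : ℕ)) = (s : K) ∧
    s - c' ^ p ∈ IsLocalRing.maximalIdeal ↥(locAtCentre B.toSubring O₁) ∧
    s - c' ^ p ∉ IsLocalRing.maximalIdeal ↥(locAtCentre B.toSubring O₁) ^ 2))) →
    ∃ (A' : Subalgebra k K), A'.toSubring ≤ O.toSubring ∧ A ≤ A' ∧ A'.FG ∧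
    ∃ (_ : IsRegularLocalRing ↥(locAtCentre A'.toSubring O)) (c : Fin p → K), (∃ j : Fin p, (j : ℕ) ≠ 0 ∧ c j ≠ 0) ∧
    ((∃ (d m : ℕ) (hmd : m ≤ d) (t : Fin d → ↥(locAtCentre A'.toSubring O)) (a : Fin m → ℕ) (u : ↥(locAtCentre A'.toSubring O)), IsUnit u ∧
    Ideal.span (Set.range t) = IsLocalRing.maximalIdeal ↥(locAtCentre A'.toSubring O) ∧
    ringKrullDim ↥(locAtCentre A'.toSubring O) = (d : WithBot ℕ∞) ∧ 0 < m ∧ (∀ i, ¬ p ∣ a i) ∧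
    (∑ j : Fin p, c j ^ p * g₀ ^ (j : ℕ)) = (u : K) * ∏ i : Fin m, ((t (Fin.castLE hmd i) : ↥(locAtCentre A'.toSubring O)) : K) ^ (a i)) ∨
    (∃ u : ↥(locAtCentre A'.toSubring O), IsUnit u ∧ (∑ j : Fin p, c j ^ p * g₀ ^ (j : ℕ)) = (u : K) ∧
    ∀ c' : ↥(locAtCentre A'.toSubring O), u - c' ^ p ∉ IsLocalRing.maximalIdeal ↥(locAtCentre A'.toSubring O)) ∨
    (∃ s c' : ↥(locAtCentre A'.toSubring O), (∑ j : Fin p, c j ^ p * g₀ ^ (j : ℕ)) = (s : K) ∧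
    s - c' ^ p ∈ IsLocalRing.maximalIdeal ↥(locAtCentre A'.toSubring O) ∧
    s - c' ^ p ∉ IsLocalRing.maximalIdeal ↥(locAtCentre A'.toSubring O) ^ 2)) := by
  intro p hp k _ _ K _ _ O A hAO hAfg hfrac hdimA hreg hdim3 hzd g₀ hg₀ hdiv O₁ hOO₁ hne hO₁ B hBO hAB hBfg hBreg hBdim hBdim₁ hrep
  obtain ⟨hreg₁, c, hc, hforms⟩ := hrep
  rcases hforms with h1 | h2 | h3
  · exact persistForm1_gen_of (centreCurve_of hReg) p hp k K O A hAO hAfg hfrac hdimA hreg hdim3 hzd g₀ hg₀ hdiv O₁ hOO₁ hne hO₁ B hBO hAB hBfg hBreg hBdim hBdim₁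
      hreg₁ c hc h1
  · exact persistForm2_gen_of (centreCurve_of hReg) p hp k K O A hAO hAfg hfrac hdimA hreg hdim3 hzd g₀ hg₀ hdiv O₁ hOO₁ hne hO₁ B hBO hAB hBfg hBreg hBdim hBdim₁
      hreg₁ c hc h2
  · exact persistForm3_gen_of (centreCurve_of hReg) p hp k K O A hAO hAfg hfrac hdimA hreg hdim3 hzd g₀ hg₀ hdiv O₁ hOO₁ hne hO₁ B hBO hAB hBfg hBreg hBdim hBdim₁
      hreg₁ c hc h3

/-- **THE (C-curve) TARGET over perfect fields, modulo the geometric core `curveRegularize` (hReg) and F-02 (hCP)** — see the module docstring. [folklore] -/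
theorem cleanLU3Defect_of_properCoarsening_gen_of
    (hReg :
    ∀ (k : Type) [Field k] (K : Type) [Field K] [Algebra k K]
    (O : ValuationSubring K) (A : Subalgebra k K), A.toSubring ≤ O.toSubring → A.FG → IsFractionRing A K → ringKrullDim A ≤ 3 →
    (∀ (T : Subring K) (hT : T ≤ O.toSubring), A.toSubring ≤ T → (subringCentre T O hT).IsMaximal) →
    ∀ (B : Subalgebra k K) (hBO : B.toSubring ≤ O.toSubring), A ≤ B → B.FG →
    IsRegularLocalRing (locAtCentre B.toSubring O) → ringKrullDim (locAtCentre B.toSubring O) = 3 →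
    ∀ (O₁ : ValuationSubring K) (hOO₁ : O ≤ O₁), ringKrullDim (locAtCentre B.toSubring O₁) = 2 →
    ∃ (B' : Subalgebra k K) (hB'O : B'.toSubring ≤ O.toSubring), B ≤ B' ∧ B'.FG ∧
    IsRegularLocalRing (locAtCentre B'.toSubring O) ∧ ringKrullDim (locAtCentre B'.toSubring O) = 3 ∧
    B'.toSubring ≤ locAtCentre B.toSubring O₁ ∧
    IsRegularLocalRing (↥(locAtCentre B'.toSubring O) ⧸
      subringCentre (locAtCentre B'.toSubring O) O₁ (fun _ hw => hOO₁ (locAtCentre_le hB'O hw))) ∧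
    ringKrullDim (↥(locAtCentre B'.toSubring O) ⧸
      subringCentre (locAtCentre B'.toSubring O) O₁ (fun _ hw => hOO₁ (locAtCentre_le hB'O hw))) = 1 )
    (hCP : CossartPiltant2019.{0}) :
    ∀ (p : ℕ), p.Prime →
    ∀ (k : Type) [Field k] [CharP k p] (K : Type) [Field K] [Algebra k K]
    (O : ValuationSubring K) (A : Subalgebra k K), A.toSubring ≤ O.toSubring → A.FG → IsFractionRing A K →
    ringKrullDim A ≤ 3 → IsRegularLocalRing (locAtCentre A.toSubring O) →
    ringKrullDim (locAtCentre A.toSubring O) = 3 →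
    (∀ (T : Subring K) (hT : T ≤ O.toSubring), A.toSubring ≤ T → (subringCentre T O hT).IsMaximal) →
    ∀ g₀ : K, (∀ c : K, c ^ p ≠ g₀) →
    ¬ (∃ (O₁ : ValuationSubring K), O ≤ O₁ ∧ O₁ ≠ ⊤ ∧ ∃ y : Fin 2 → K, (∀ i, y i ∈ O) ∧
      ∀ P : MvPolynomial (Fin 2) k, P ≠ 0 → O₁.valuation (MvPolynomial.aeval y P) = 1) →
    ∀ (O₁ : ValuationSubring K), O ≤ O₁ → O₁ ≠ O → O₁ ≠ ⊤ →
    ∃ (A' : Subalgebra k K), A'.toSubring ≤ O.toSubring ∧ A ≤ A' ∧ A'.FG ∧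
    ∃ (_ : IsRegularLocalRing ↥(locAtCentre A'.toSubring O)) (c : Fin p → K), (∃ j : Fin p, (j : ℕ) ≠ 0 ∧ c j ≠ 0) ∧
    ((∃ (d m : ℕ) (hmd : m ≤ d) (t : Fin d → ↥(locAtCentre A'.toSubring O)) (a : Fin m → ℕ) (u : ↥(locAtCentre A'.toSubring O)), IsUnit u ∧
    Ideal.span (Set.range t) = IsLocalRing.maximalIdeal ↥(locAtCentre A'.toSubring O) ∧
    ringKrullDim ↥(locAtCentre A'.toSubring O) = (d : WithBot ℕ∞) ∧ 0 < m ∧ (∀ i, ¬ p ∣ a i) ∧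
    (∑ j : Fin p, c j ^ p * g₀ ^ (j : ℕ)) = (u : K) * ∏ i : Fin m, ((t (Fin.castLE hmd i) : ↥(locAtCentre A'.toSubring O)) : K) ^ (a i)) ∨
    (∃ u : ↥(locAtCentre A'.toSubring O), IsUnit u ∧ (∑ j : Fin p, c j ^ p * g₀ ^ (j : ℕ)) = (u : K) ∧
    ∀ c' : ↥(locAtCentre A'.toSubring O), u - c' ^ p ∉ IsLocalRing.maximalIdeal ↥(locAtCentre A'.toSubring O)) ∨
    (∃ s c' : ↥(locAtCentre A'.toSubring O), (∑ j : Fin p, c j ^ p * g₀ ^ (j : ℕ)) = (s : K) ∧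
    s - c' ^ p ∈ IsLocalRing.maximalIdeal ↥(locAtCentre A'.toSubring O) ∧
    s - c' ^ p ∉ IsLocalRing.maximalIdeal ↥(locAtCentre A'.toSubring O) ^ 2)) := by
  intro p hp k _ _ K _ _ O A hAO hAfg hfrac hdimA hreg hdim3 hzd g₀ hg₀ hdiv O₁ hOO₁ hne hO₁
  obtain ⟨B, hBO, hAB, hBfg, hBreg, hBdim, hBdim₁, hrep⟩ :=
    liftedD2_gen_of hReg hCP p hp k K O A hAO hAfg hfrac hdimA hreg hdim3 hzd g₀ hg₀ hdiv O₁ hOO₁ hne hO₁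
  exact persist_gen_of hReg p hp k K O A hAO hAfg hfrac hdimA hreg hdim3 hzd g₀ hg₀ hdiv O₁ hOO₁ hne hO₁ B hBO hAB hBfg hBreg hBdim hBdim₁ hrep

end Summit.ResolutionOfSingularities.ResolutionOfSingularities.Theorems.RadicialJung.CleanModels.Ccurve

end
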